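import Summits.BirchSwinnertonDyer.Rank1Residual.Additive.SignedTwistSelmerInfty
import HarnessLib

/-!
# (T-O7ss-P5, file P5-4b, part 2) (D3): `Θ_∞ (Sel^{−,str}(W/ℚ_∞)) = Sel⁻(V/K₀ℚ_∞)^η`

Cell n1011 (b2b / bsd-rank1-residual), row T-O7ss-P13 follow-up (P5), skeleton
`cells/n1011/skel/T-O7ss-P5.md` §2 (D3); sequel of `SignedTwistSelmerInfty.lean` (split for the
400-line rule); designs (A)/(B) approved (referee-1 GEN 22 ACK-1, lead R5-69 (m) / R5-71;
cc-typer-6 GEN 12 (Q1)–(Q4)).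

HONEST FRAMING. The programme this file serves is a CONDITIONAL ASSEMBLY of the
Birch–Swinnerton-Dyer formula for ALL analytic-rank `≤ 1` elliptic curves over `ℚ` — "full BSD
formula for every rank `≤ 1` curve in class `C`" assembled STRICTLY from published theorems — so
that the rank-`≤ 1` remainder becomes exactly the CONSTRUCTION-SHAPED classes, which are TYPED
(missing-input `Prop`s), NOT attempted. This is not "finishing BSD". Research route on
O7-ss ∩ (G)∧ss ∩ e = 2 (OPEN) / X4 CONSTRUCTION-SHAPED; nothing here is booked; no label moves.
TOOL THEOREMS ONLY: no definition, no named Literature fact, no `sorry`; axioms standard.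

Binders: `hD` = (D0) at `closureEmb E`; `hκ₀` (RESHAPE, P5-2a: `κ(Gal(ℚ̄/K₀)) = ℤ_p`);
`hcop : p ∤ [Γ_ℚ : Gal(ℚ̄/K₀)]`; `[(galRange K₀).Normal]`; `hη`. No `p ≠ 2`, no `IsElliptic`
(binder diff vs. the GEN 6 signature scratch 6d7079126fd5332b: `[W.IsElliptic] [V.IsElliptic]`
DROPPED, `hκ₀` ADDED, `LocalTowerHyp` unfolded as `hD`).

## What is proved
* `index_nsmul_sum_eta_conjH1_resOfLe_mem`: for `d ∈ Sel⁻(V/K₀ℚ_n)` and representatives `r_i` of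
  `L_n/U_n`, `[Γ:G₀] · Σ_i η(r_i)·conj_{r_i} (res d) ∈ Θ_∞(Sel^{−,str}(W/ℚ_∞))` — write `d = Θ_* y`,
  the signs cancel on the `W`-side, the norm `Σ conj_{r_i} y` is `L_n`-invariant hence a
  restriction up to `[L_n:U_n]` (additive-p2's `exists_resOfLe_eq_relIndex_nsmul_rel`), and the
  preimage is strict-signed Selmer by (D2);
* `towerSignedSelmerInftyEta_le_map_h1TransportInfty` (⊇): average over representatives
  `q̃ ∈ ker κ` of `Q = ker κ/U_∞` — representatives of EVERY `L_n/U_n`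
  (`exists_equiv_kerQuotient_layerQuotient`) — so ONE operator `A = Σ_q η(q̃) conj_{q̃}` works on all
  generators of `Sel⁻(V/K₀ℚ_∞) = ⋃_n res Sel⁻(V/K₀ℚ_n)`; on an `η`-eigenclass `A = |Q|`, and
  `[Γ:G₀]·|Q|` is prime to `p` on a `p`-primary group;
* **`map_h1TransportInfty_strictSignedSelmerInfty`** ((D3)):
  `Θ_∞ (Sel^{−,str}(W/ℚ_∞)) = Sel⁻(V/K₀ℚ_∞)^η`, and its membership form
  `mem_strictSignedSelmerInfty_iff_h1TransportInfty`.

References: S. Kobayashi, Invent. Math. 152 (2003) Def. 2.1, §4 p. 8 (`M^η = ε_η M`)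
[Kobayashi2003]; T. & V. Dokchitser, Ann. of Math. 172 (2010) Lemma 4.14 (proof)
[DokchitserDokchitserAnnals2010]; R. Greenberg, LNM 1716 (1999) §5 p. 143 [GreenbergLNM1716].
-/

noncomputable section

open scoped Classical

open WeierstrassCurve Field

namespace Summit.BirchSwinnertonDyer.Rank1Residual.Additive.SignedTwist

open Literature.NumberTheory.EllipticCurves Literature.NumberTheory.GaloisRepresentations
  Literature.NumberTheory.EllipticCurves.Kobayashi2003
  Summit.BirchSwinnertonDyer.Rank1Residual.AdditivePotMult ZpExtension

variable (W : WeierstrassCurve ℚ) (K₀ : Type) [Field K₀] [NumberField K₀] {θ : K₀} {c : ℚ}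
  (hθ : θ ∉ Set.range (algebraMap ℚ K₀)) (hc : θ ^ 2 = algebraMap ℚ K₀ c)
  (p : ℕ) [Fact p.Prime] (κ : ZpExtension ℚ p)
  {V : WeierstrassCurve ℚ} {C : VariableChange ℚ} (hCV : C • W.quadraticTwist c = V)
  (E : Type) [Field E] [Algebra ℚ E]
  (η : absoluteGaloisGroup ℚ →* ℤˣ)
  (hη : ∀ σ : absoluteGaloisGroup ℚ, η σ = 1 ↔ σ • rootInClosure K₀ θ = rootInClosure K₀ θ)

/-! ## §1 The `η`-average of a restricted layer class -/

include hη in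
/-- **The `η`-average of a restricted layer class is hit, up to `[Γ_ℚ : Gal(ℚ̄/K₀)]`**: for
`d ∈ Sel⁻(V/K₀ℚ_n)` and a family `r_i ∈ L_n` of representatives of `L_n/U_n`,
`[Γ:G₀] · Σ_i η(r_i)·conj_{r_i} (res_{U_∞ ≤ U_n} d) ∈ Θ_∞ (Sel^{−,str}(W/ℚ_∞))`. Proof: write
`d = Θ_* y`; the signs cancel on the `W`-side (`sum_eta_smul_conjH1_h1Transport`); the norm
`Σ conj_{r_i} y` is `L_n`-invariant, hence `[L_n:U_n] ·` it is `res x` for an `x ∈ H¹(ℚ_n, W[p^∞])`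
(`exists_resOfLe_eq_relIndex_nsmul_rel`), and `x ∈ Sel^{−,str}(W/ℚ_n)` by (D2) since `Θ_n x` is a
sum of conjugates of `d`. [cite: Kobayashi2003, Def. 2.1 (p. 5), §4 p. 8]
[cite: DokchitserDokchitserAnnals2010, Lemma 4.14 (proof)] -/
theorem index_nsmul_sum_eta_conjH1_resOfLe_mem [(galRange (K := ℚ) K₀).Normal]
    (hD : ∀ g : absoluteGaloisGroup ℚ, ∃ τ : absoluteGaloisGroup E,
      (resGalOfEmb (closureEmb (K := ℚ) E) τ)⁻¹ * g ∈ towerTopSubgroup κ K₀)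
    (hκ₀ : ∀ x, ∃ g ∈ galRange (K := ℚ) K₀, κ g = x)
    (hcop : (galRange (K := ℚ) K₀).index.Coprime p)
    {ι : Type*} [Fintype ι] (r : ι → absoluteGaloisGroup ℚ) (n : ℕ)
    (hr : ∀ i, r i ∈ κ.layerSubgroup n)
    (hbij : Function.Bijective fun i ↦ (QuotientGroup.mk (⟨r i, hr i⟩ : κ.layerSubgroup n) :
      κ.layerSubgroup n ⧸ (towerSubgroup κ K₀ n).subgroupOf (κ.layerSubgroup n)))
    {d : V.subgroupH1 p (towerSubgroup κ K₀ n)} (hd : d ∈ towerSignedSelmerLayer V κ K₀ E (-1) n) :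
    (galRange (K := ℚ) K₀).index •
        ∑ i, ((η (r i) : ℤˣ) : ℤ) • V.conjH1 p (towerTopSubgroup κ K₀) (r i)
          (V.resOfLe p (towerTopSubgroup_le κ K₀ n) d) ∈
      (strictSignedSelmerInfty W κ E (-1)).map (h1TransportInfty W K₀ hθ hc p κ hCV) := by
  have h1 := towerSubgroup_le_layerSubgroup K₀ p κ n
  have h2 := towerTopSubgroup_le κ K₀ n
  have hUn := towerSubgroup_le_galRange κ K₀ n
  -- write `d = Θ_* y`
  obtain ⟨y, rfl⟩ : ∃ y, h1Transport W K₀ hθ hc p hCV (towerSubgroup κ K₀ n) hUn y = d :=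
    ⟨_, AddEquiv.apply_symm_apply _ d⟩
  -- (a) move the restriction out of the average
  have ha : ∑ i, ((η (r i) : ℤˣ) : ℤ) • V.conjH1 p (towerTopSubgroup κ K₀) (r i)
        (V.resOfLe p h2 (h1Transport W K₀ hθ hc p hCV (towerSubgroup κ K₀ n) hUn y)) =
      V.resOfLe p h2 (∑ i, ((η (r i) : ℤˣ) : ℤ) • V.conjH1 p (towerSubgroup κ K₀ n) (r i)
        (h1Transport W K₀ hθ hc p hCV (towerSubgroup κ K₀ n) hUn y)) := by
    rw [map_sum]
    refine Finset.sum_congr rfl fun i _ ↦ ?_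
    rw [map_zsmul, ← AddMonoidHom.comp_apply (V.conjH1 p (towerTopSubgroup κ K₀) (r i))
      (V.resOfLe p h2), ← resOfLe_comp_conjH1_holds (M := V.geomPrimaryTorsion p) h2 (r i),
      AddMonoidHom.comp_apply]
  -- (b) the signs cancel on the `W`-side
  have hb := sum_eta_smul_conjH1_h1Transport W K₀ hθ hc p hCV η hη r (towerSubgroup κ K₀ n) hUn y
  -- (c) the norm is `L_n`-invariant, hence a restriction up to `[L_n : U_n]`
  haveI : ((towerSubgroup κ K₀ n).subgroupOf (κ.layerSubgroup n)).FiniteIndex :=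
    ⟨fun h0 ↦ Subgroup.FiniteIndex.index_ne_zero (H := galRange (K := ℚ) K₀)
      (Nat.eq_zero_of_zero_dvd ((show (towerSubgroup κ K₀ n).relIndex (κ.layerSubgroup n) = 0
        from h0) ▸ relIndex_tower_layer_dvd K₀ p κ n))⟩
  have hopen : IsOpen (((towerSubgroup κ K₀ n).subgroupOf (κ.layerSubgroup n) :
      Subgroup (κ.layerSubgroup n)) : Set (κ.layerSubgroup n)) :=
    isOpen_subgroupOf_of_eq_inf (isOpen_galRange K₀) rfl
  have hinv : ∀ g : κ.layerSubgroup n,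
      W.conjH1 p (towerSubgroup κ K₀ n) (g : absoluteGaloisGroup ℚ)
          (∑ i, W.conjH1 p (towerSubgroup κ K₀ n) (r i) y) =
        ∑ i, W.conjH1 p (towerSubgroup κ K₀ n) (r i) y :=
    fun g ↦ conjH1_sum_conjH1_of_bijective W p r hr hbij g y
  obtain ⟨x, hx⟩ :=
    exists_resOfLe_eq_relIndex_nsmul_rel (W.geomPrimaryTorsion p) h1 hopen hinv
  -- (d) `x ∈ Sel^{−,str}(W/ℚ_n)` by (D2): `Θ_n x` is a sum of conjugates of `d`
  have hsmem : ∑ i, ((η (r i) : ℤˣ) : ℤ) • V.conjH1 p (towerSubgroup κ K₀ n) (r i)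
        (h1Transport W K₀ hθ hc p hCV (towerSubgroup κ K₀ n) hUn y) ∈
      towerSignedSelmerLayer V κ K₀ E (-1) n :=
    AddSubgroup.sum_mem _ fun i _ ↦ AddSubgroup.zsmul_mem _
      (conjH1_mem_towerSignedSelmerLayer V κ K₀ E (-1) n (r i) hd) _
  have hΘx : h1TransportLayer W K₀ hθ hc p κ hCV n x =
      (towerSubgroup κ K₀ n).relIndex (κ.layerSubgroup n) •
        ∑ i, ((η (r i) : ℤˣ) : ℤ) • V.conjH1 p (towerSubgroup κ K₀ n) (r i)
          (h1Transport W K₀ hθ hc p hCV (towerSubgroup κ K₀ n) hUn y) := by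
    rw [AddMonoidHom.comp_apply, AddMonoidHom.coe_coe]
    change h1Transport W K₀ hθ hc p hCV (towerSubgroup κ K₀ n) hUn
      (resOfLe (W.geomPrimaryTorsion p) h1 x) = _
    rw [hx, map_nsmul, hb]
  have hxmem : x ∈ strictSignedSelmerLayer W κ E (-1) n := by
    rw [mem_strictSignedSelmerLayer_iff_h1TransportLayer W K₀ hθ hc p κ hCV E η hη hD hκ₀ hcop n x,
      hΘx]
    exact AddSubgroup.nsmul_mem _ hsmem _
  -- (e) assemble with the square
  obtain ⟨k, hk⟩ := relIndex_tower_layer_dvd K₀ p κ n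
  rw [ha, hk, mul_nsmul]
  refine AddSubgroup.nsmul_mem _ ?_ k
  refine ⟨W.layerToInfty κ n x,
    map_layerToInfty_strictSignedSelmerLayer_le W κ E (-1) n ⟨x, hxmem, rfl⟩, ?_⟩
  rw [h1TransportInfty_layerToInfty, hΘx, map_nsmul]

/-! ## §2 `Sel⁻(V/K₀ℚ_∞)^η ⊆ Θ_∞ (Sel^{−,str}(W/ℚ_∞))` and (D3) -/

include hη in
/-- **(D3, ⊇)**: every `η`-eigenclass `t ∈ Sel⁻(V/K₀ℚ_∞)` is `Θ_∞` of a strict signed class.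
Average over representatives `q̃ ∈ ker κ` of `Q = ker κ/U_∞` (representatives of every `L_n/U_n`,
`exists_equiv_kerQuotient_layerQuotient`): `[Γ:G₀] · A(t') ∈ Θ_∞(Sel^{−,str})` for EVERY
`t' ∈ Sel⁻(V/K₀ℚ_∞)` (`index_nsmul_sum_eta_conjH1_resOfLe_mem` on generators, additivity), while
`A(t) = |Q| · t` for `t` `η`-eigen; `[Γ:G₀]·|Q|` is prime to `p` and `t` is `p`-primary.
[cite: Kobayashi2003, Def. 2.1 (p. 5), §4 p. 8 (M^η = ε_η M)] [cite: GreenbergLNM1716, §5 p. 143] -/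
theorem towerSignedSelmerInftyEta_le_map_h1TransportInfty [(galRange (K := ℚ) K₀).Normal]
    (hD : ∀ g : absoluteGaloisGroup ℚ, ∃ τ : absoluteGaloisGroup E,
      (resGalOfEmb (closureEmb (K := ℚ) E) τ)⁻¹ * g ∈ towerTopSubgroup κ K₀)
    (hκ₀ : ∀ x, ∃ g ∈ galRange (K := ℚ) K₀, κ g = x)
    (hcop : (galRange (K := ℚ) K₀).index.Coprime p) :
    towerSignedSelmerInftyEta V κ K₀ E η (-1) ≤
      (strictSignedSelmerInfty W κ E (-1)).map (h1TransportInfty W K₀ hθ hc p κ hCV) := by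
  intro t ht
  obtain ⟨ht, heig⟩ := (mem_towerSignedSelmerInftyEta_iff V κ K₀ E η (-1) t).mp ht
  haveI hFI : ((towerTopSubgroup κ K₀).subgroupOf κ.kerSubgroup).FiniteIndex :=
    ⟨fun h0 ↦ Subgroup.FiniteIndex.index_ne_zero (H := galRange (K := ℚ) K₀)
      (Nat.eq_zero_of_zero_dvd ((show (towerTopSubgroup κ K₀).relIndex κ.kerSubgroup = 0
        from h0) ▸ relIndex_towerTop_ker_dvd K₀ p κ))⟩
  haveI : Fintype (κ.kerSubgroup ⧸ (towerTopSubgroup κ K₀).subgroupOf κ.kerSubgroup) :=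
    Fintype.ofFinite _
  -- representatives `q̃ ∈ ker κ` of `Q = ker κ / U_∞`
  have hrk : ∀ q : κ.kerSubgroup ⧸ (towerTopSubgroup κ K₀).subgroupOf κ.kerSubgroup,
      ((Quotient.out q : κ.kerSubgroup) : absoluteGaloisGroup ℚ) ∈ κ.kerSubgroup :=
    fun q ↦ (Quotient.out q).2
  -- Step 1: `[Γ:G₀] · A(t') ∈ Θ_∞ (Sel^{−,str}(W/ℚ_∞))` for every `t' ∈ Sel⁻(V/K₀ℚ_∞)`
  have havg : ∀ t' ∈ towerSignedSelmerInfty V κ K₀ E (-1),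
      (galRange (K := ℚ) K₀).index •
          ∑ q : κ.kerSubgroup ⧸ (towerTopSubgroup κ K₀).subgroupOf κ.kerSubgroup,
            ((η ((Quotient.out q : κ.kerSubgroup) : absoluteGaloisGroup ℚ) : ℤˣ) : ℤ) •
              V.conjH1 p (towerTopSubgroup κ K₀)
                ((Quotient.out q : κ.kerSubgroup) : absoluteGaloisGroup ℚ) t' ∈
        (strictSignedSelmerInfty W κ E (-1)).map (h1TransportInfty W K₀ hθ hc p κ hCV) := by
    intro t' ht'
    refine AddSubgroup.iSup_induction
      (fun n ↦ (towerSignedSelmerLayer V κ K₀ E (-1) n).map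
        (V.resOfLe p (towerTopSubgroup_le κ K₀ n)))
      (C := fun t' ↦ (galRange (K := ℚ) K₀).index •
          ∑ q : κ.kerSubgroup ⧸ (towerTopSubgroup κ K₀).subgroupOf κ.kerSubgroup,
            ((η ((Quotient.out q : κ.kerSubgroup) : absoluteGaloisGroup ℚ) : ℤˣ) : ℤ) •
              V.conjH1 p (towerTopSubgroup κ K₀)
                ((Quotient.out q : κ.kerSubgroup) : absoluteGaloisGroup ℚ) t' ∈
        (strictSignedSelmerInfty W κ E (-1)).map (h1TransportInfty W K₀ hθ hc p κ hCV))
      ht' ?_ ?_ ?_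
    · rintro n _ ⟨d, hd, rfl⟩
      obtain ⟨e, he⟩ := exists_equiv_kerQuotient_layerQuotient K₀ p κ hκ₀ n
      have hbij : Function.Bijective
          fun q : κ.kerSubgroup ⧸ (towerTopSubgroup κ K₀).subgroupOf κ.kerSubgroup ↦
            (QuotientGroup.mk (⟨((Quotient.out q : κ.kerSubgroup) : absoluteGaloisGroup ℚ),
              κ.kerSubgroup_le_layerSubgroup n (hrk q)⟩ : κ.layerSubgroup n) :
              κ.layerSubgroup n ⧸ (towerSubgroup κ K₀ n).subgroupOf (κ.layerSubgroup n)) := by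
        convert e.bijective using 1
        funext q
        conv_rhs => rw [← QuotientGroup.out_eq' q, he]
        rfl
      exact index_nsmul_sum_eta_conjH1_resOfLe_mem W K₀ hθ hc p κ hCV E η hη hD hκ₀ hcop _ n _
        hbij hd
    · rw [Finset.sum_eq_zero fun q _ ↦ by rw [map_zero, zsmul_zero], nsmul_zero]
      exact zero_mem _
    · intro a b ha hb
      have hsplit : ∑ q : κ.kerSubgroup ⧸ (towerTopSubgroup κ K₀).subgroupOf κ.kerSubgroup,
          ((η ((Quotient.out q : κ.kerSubgroup) : absoluteGaloisGroup ℚ) : ℤˣ) : ℤ) •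
            V.conjH1 p (towerTopSubgroup κ K₀)
              ((Quotient.out q : κ.kerSubgroup) : absoluteGaloisGroup ℚ) (a + b) =
          ∑ q : κ.kerSubgroup ⧸ (towerTopSubgroup κ K₀).subgroupOf κ.kerSubgroup,
            ((η ((Quotient.out q : κ.kerSubgroup) : absoluteGaloisGroup ℚ) : ℤˣ) : ℤ) •
              V.conjH1 p (towerTopSubgroup κ K₀)
                ((Quotient.out q : κ.kerSubgroup) : absoluteGaloisGroup ℚ) a +
          ∑ q : κ.kerSubgroup ⧸ (towerTopSubgroup κ K₀).subgroupOf κ.kerSubgroup,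
            ((η ((Quotient.out q : κ.kerSubgroup) : absoluteGaloisGroup ℚ) : ℤˣ) : ℤ) •
              V.conjH1 p (towerTopSubgroup κ K₀)
                ((Quotient.out q : κ.kerSubgroup) : absoluteGaloisGroup ℚ) b := by
        rw [← Finset.sum_add_distrib]
        exact Finset.sum_congr rfl fun q _ ↦ by rw [map_add, zsmul_add]
      rw [hsplit, nsmul_add]
      exact add_mem ha hb
  -- Step 2: on the `η`-eigenclass `t` the average is `|Q| • t`
  have hsum : ∑ q : κ.kerSubgroup ⧸ (towerTopSubgroup κ K₀).subgroupOf κ.kerSubgroup,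
      ((η ((Quotient.out q : κ.kerSubgroup) : absoluteGaloisGroup ℚ) : ℤˣ) : ℤ) •
        V.conjH1 p (towerTopSubgroup κ K₀)
          ((Quotient.out q : κ.kerSubgroup) : absoluteGaloisGroup ℚ) t =
      Fintype.card (κ.kerSubgroup ⧸ (towerTopSubgroup κ K₀).subgroupOf κ.kerSubgroup) • t := by
    refine (Finset.sum_congr rfl fun q _ ↦ ?_ : _ = ∑ _q : κ.kerSubgroup ⧸
      (towerTopSubgroup κ K₀).subgroupOf κ.kerSubgroup, t).trans ?_
    · rw [heig _ (hrk q), units_smul_units_smul]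
    · rw [Finset.sum_const, Finset.card_univ]
  -- Step 3: `[Γ:G₀]·|Q|` is prime to `p` and `t` is `p`-primary
  have hcard : Fintype.card (κ.kerSubgroup ⧸ (towerTopSubgroup κ K₀).subgroupOf κ.kerSubgroup) ∣
      (galRange (K := ℚ) K₀).index := by
    rw [← Nat.card_eq_fintype_card]
    exact relIndex_towerTop_ker_dvd K₀ p κ
  have hclosed : IsClosed ((towerTopSubgroup κ K₀ : Subgroup (absoluteGaloisGroup ℚ)) :
      Set (absoluteGaloisGroup ℚ)) :=
    κ.isClosed_kerSubgroup.inter (Subgroup.isClosed_of_isOpen _ (isOpen_galRange K₀))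
  obtain ⟨j, hj⟩ := exists_pow_nsmul_eq_zero_subgroupH1_of_isClosed V p hclosed t
  have hmem := havg t ht
  rw [hsum, ← mul_nsmul'] at hmem
  exact mem_of_coprime_nsmul_mem p _ hj
    (Nat.Coprime.mul_left hcop (Nat.Coprime.coprime_dvd_left hcard hcop)) hmem

include hη in
/-- **(D3) THE SELMER DICTIONARY AT THE TOP: `Θ_∞ (Sel^{−,str}(W/ℚ_∞)) = Sel⁻(V/K₀ℚ_∞)^η`** —
p17's strict signed Selmer group of `W` over the cyclotomic `ℤ_p`-tower of `ℚ` IS, under `Θ_∞`,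
the `η`-component of cc-typer-6's verbatim Kobayashi `Sel⁻(V/K_∞)`, `K_∞ = K₀ℚ_∞`.
[cite: Kobayashi2003, Def. 2.1 (p. 5), §4 p. 8 (X⁻(E/K_∞)^η)] -/
theorem map_h1TransportInfty_strictSignedSelmerInfty [(galRange (K := ℚ) K₀).Normal]
    (hD : ∀ g : absoluteGaloisGroup ℚ, ∃ τ : absoluteGaloisGroup E,
      (resGalOfEmb (closureEmb (K := ℚ) E) τ)⁻¹ * g ∈ towerTopSubgroup κ K₀)
    (hκ₀ : ∀ x, ∃ g ∈ galRange (K := ℚ) K₀, κ g = x)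
    (hcop : (galRange (K := ℚ) K₀).index.Coprime p) :
    (strictSignedSelmerInfty W κ E (-1)).map (h1TransportInfty W K₀ hθ hc p κ hCV) =
      towerSignedSelmerInftyEta V κ K₀ E η (-1) :=
  le_antisymm
    (map_h1TransportInfty_strictSignedSelmerInfty_le W K₀ hθ hc p κ hCV E η hη hD hκ₀ hcop)
    (towerSignedSelmerInftyEta_le_map_h1TransportInfty W K₀ hθ hc p κ hCV E η hη hD hκ₀ hcop)

include hη in
/-- **(D3), membership form**: `s ∈ Sel^{−,str}(W/ℚ_∞) ↔ Θ_∞ s ∈ Sel⁻(V/K₀ℚ_∞)^η`.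
[cite: Kobayashi2003, Def. 2.1 (p. 5), §4 p. 8] -/
theorem mem_strictSignedSelmerInfty_iff_h1TransportInfty [(galRange (K := ℚ) K₀).Normal]
    (hD : ∀ g : absoluteGaloisGroup ℚ, ∃ τ : absoluteGaloisGroup E,
      (resGalOfEmb (closureEmb (K := ℚ) E) τ)⁻¹ * g ∈ towerTopSubgroup κ K₀)
    (hκ₀ : ∀ x, ∃ g ∈ galRange (K := ℚ) K₀, κ g = x)
    (hcop : (galRange (K := ℚ) K₀).index.Coprime p) (s : W.subgroupH1 p κ.kerSubgroup) :
    s ∈ strictSignedSelmerInfty W κ E (-1) ↔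
      h1TransportInfty W K₀ hθ hc p κ hCV s ∈ towerSignedSelmerInftyEta V κ K₀ E η (-1) := by
  rw [← map_h1TransportInfty_strictSignedSelmerInfty W K₀ hθ hc p κ hCV E η hη hD hκ₀ hcop]
  constructor
  · exact fun hs ↦ ⟨s, hs, rfl⟩
  · rintro ⟨s', hs', he⟩
    rwa [← h1TransportInfty_injective W K₀ hθ hc p κ hCV hcop he]

end Summit.BirchSwinnertonDyer.Rank1Residual.Additive.SignedTwist

end
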